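/-
Copyright: cell pub-balaban-gaps, seat ne8 (estimate NE7c), gen 16. Project licence.
-/
import Literature.MathematicalPhysics.QuantumFieldTheory.Balaban1983to89.T4ShellMeasure

/-!
# Road (δ)'s END-TO-END constructor FIRES on measure-valued two-run data with NO regularity of the laws: the one-stage,
# one-test MODEL of the live common factor — for ANY two probability laws `μ_A`, `μ_B` on `ℝ` (the two runs' tested variable),
# ANY thresholds `θ_K ≥ 0`, own shell half-widths `ρ_K` with `2ρ_K ≤ ρ⋆_K = c₁ϑ^K ≤ β′∕2`, the candidates `θ_K(1 − ρ⋆_K)^i`, `i < ⌊β′∕ρ⋆_K⌋₊`,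
# `T4ShellMeasure.shellWeightBound_of_liveFactor` yields ONE choice function and `T4IndicatorShell.ShellWeightBound` BY NAME —
# disjointness of the candidate shells alone, no density bound, no anti-concentration (row NE7c; junction J-20; MODEL, [folklore])

Cell `pub-balaban-gaps` (G2), seat ne8, estimate **NE7c** (`T4IndicatorShell.ShellWeightBound`; two-run artefact, NOT PRINTED in [Bałaban 1983–89], NOT
PROVED).  Proof-only file under `Spine/NE7c/`: imports the tree's `Balaban1983to89.T4ShellMeasure` only (v4: `twoSidedShell`, `twoSidedShell_disjoint`,
`candidateCount_spec`, `SlotLedger.of_realized`, `shellWeightBound_of_liveFactor`).  Mathlib measure theory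
otherwise.  Nothing of Bałaban's is named; no `def`; 0 `sorry`.

THE QUESTION (HANDOFF § GEN 15, optional open point (vii); `ne/NE7c-PLAIN.md` item 4 «NO analytic input on the laws, NO anti-concentration»).  The typed
reduction of road (δ) ends in `T4ShellMeasure.shellWeightBound_of_liveFactor` (member (δ-1): ONE common factor `λ_i = (1 − ρ⋆)^i` on every live
threshold; a choice FUNCTION `K ↦ i⋆_K` from the two-run pigeonhole on candidate-summed shell totals; realized ledgers).  Gens 7∕8 inhabited its
hypothesis list with INDICATOR toys (shell weight `1` on candidate `0`, else `0`; probes `GlobalCompact*.probe`, not filed).  Is the list inhabited by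
genuinely MEASURE-VALUED two-run data, and what does the constructor consume of the laws?

ANSWER ([folklore]; the simplest honest instance — ONE live stage inserting ONE threshold test per run).  Run `X ∈ {A, B}` tests a real variable
with law `μ_X` (ANY probability measure on `ℝ` — atoms allowed) against the candidate threshold `θ_K·(1 − ρ⋆_K)^i`; its two TERMS are the leaves
«small» (`u < θλ_i`, weight `μ_X(Iio)`; a small-field slot, shell BELOW the threshold: `T4IndicatorShell.shellBelow`) and «large» (`u ≥ θλ_i`, weight
`μ_X(Ici)`; a large-field slot, shell ABOVE: `shellAbove`), total weight `1` at every source `t` (no `t`-dependence, tilt `a = 0`); the SHELL PARTS are the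
masses of `[θλ_i(1 − ρ^X_K), θλ_i)` resp. `[θλ_i, θλ_i(1 + ρ^X_K))`, together the tree's `twoSidedShell θ ρ⋆ ρ^X i`, `2ρ^X_K ≤ ρ⋆_K` (print's dictionary:
`ρ⋆` = twice the largest live closeness radius); ONE slot per `K`, piece = shell part.
* §1 `measureReal_twoSidedShell_eq`, `sum_measureReal_twoSidedShell_le_one`: the two-sided shells of the `n` candidates are pairwise disjoint
  (`twoSidedShell_disjoint`), so their masses sum to `≤ 1` for EVERY probability law — the (δ-1) member's cascade bound with `V = 1`, by disjointness alone.
* §2 `leaf_total_eq_one`, `realizedLedger`: for EVERY choice function the run's data form a realized slot ledger (`SlotLedger.of_realized`, `a = 0`).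
* §3 **`shellWeightBound_oneStage`**: with `ρ⋆_K = c₁ϑ^K`, `0 < c₁`, `2c₁ ≤ β′ ≤ 1`, `0 < ϑ < 1`, `n_K = ⌊β′∕ρ⋆_K⌋₊` (`candidateCount_rate`: `n_K ≥ 1`,
  `2∕n_K ≤ (4c₁∕β′)·ϑ^K`), `shellWeightBound_of_liveFactor` FIRES: `∃ i⋆, (∀ K, i⋆ K < n_K) ∧ ShellWeightBound l₀ T A B shA shB Wsh` with
  `Wsh K = μ_A(twoSidedShell^A_{i⋆K}) + μ_B(twoSidedShell^B_{i⋆K})` (the realized ledgers' `ω^A_K + ω^B_K`, by `funext`), for the two runs written with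
  `λ_{i⋆ K}` — for ALL `μ_A, μ_B, θ, ρ^A, ρ^B, l₀`; **`chosen_threshold_mem_slack`**: every candidate (hence the chosen one) keeps
  its threshold in the printed slack `[θ_K(1 − β′), θ_K]` — the domain on which (L1-step) is read.

WHAT THIS SHOWS ∕ DOES NOT SHOW (honest).  SHOWS: the hypothesis list of the (δ-1) constructor is inhabited by measure-valued two-run data, and the
ONLY property of the laws it consumes is `Σ_i μ(shell_i) ≤ μ(ℝ)` — positivity + disjointness; NO density bound (`DensityBound`), NO transversality,
NO anti-concentration (`SlotAntiConcentration`) — exactly `ne/NE7c-PLAIN.md` item 4's «NO analytic input on the laws».  DOES NOT SHOW: anything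
about Bałaban's expansion (node O: the terms of [B14] (2.18) as a Lean object; many stages ∕ tests per stage — the cascade count `V = 2(∏(ν_σ+1) − 1)`
of `T4ShellMeasure` §8 is not exercised beyond `S = 1`, `ν = 1`), nor (L1-step) (consumed downstream, by the junction files 1–36).  BY-NAME EFFECT ON
THE WALL: none (MODEL).  VERDICT WORD UNCHANGED: WORK-bound behind node O; INSTANCE 0∕1.  NE7c ∕ NE7b NOT PRINTED ∕ NOT PROVED; spine 0∕9; one
finite T⁴ — NOT ℝ⁴, NOT infinite volume, NOT the mass gap, NOT Clay.
HONEST DEPENDENCY (cell): continuum YM on T⁴ ⇐ BetaPertH ∧ nine spine estimates (0∕9 proved); BetaPertH ⇐ (D1) ∧ (D4) ∧ CAP+tail.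
-/

set_option autoImplicit false

noncomputable section

open MeasureTheory Finset Set
open Literature.MathematicalPhysics.QuantumFieldTheory.Balaban1983to89
open Literature.MathematicalPhysics.QuantumFieldTheory.Balaban1983to89.T4ShellMeasure

namespace Summit.QuantumFields.BalabanUV.T4Continuum.Spine.NE7c.LiveFactorOneStageModel

/-! ## §1 Disjointness alone: the two-sided shells of the candidates carry total mass `≤ 1` under ANY probability law -/

section Disjoint

variable (μ : Measure ℝ) [IsProbabilityMeasure μ]

/-- The two-sided shell splits at the threshold into the BELOW part (small-field slot) and the ABOVE part (large-field slot):
`μ[θλ(1 − ρ), θλ) + μ[θλ, θλ(1 + ρ)) = μ(twoSidedShell θ ρ⋆ ρ i)`, `λ = (1 − ρ⋆)^i` (`0 ≤ θ`, `0 ≤ ρ`, `ρ⋆ ≤ 1`). [folklore] -/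
theorem measureReal_twoSidedShell_eq {θ ρ ρstar : ℝ} (hθ : 0 ≤ θ) (hρ0 : 0 ≤ ρ) (h1 : ρstar ≤ 1) (i : ℕ) :
    μ.real (Ico (θ * (1 - ρstar) ^ i * (1 - ρ)) (θ * (1 - ρstar) ^ i)) + μ.real (Ico (θ * (1 - ρstar) ^ i) (θ * (1 - ρstar) ^ i * (1 + ρ))) =
      μ.real (twoSidedShell θ ρstar ρ i) := by
  have h0 : 0 ≤ θ * (1 - ρstar) ^ i := mul_nonneg hθ (pow_nonneg (by linarith) _)
  rw [twoSidedShell, ← Ico_union_Ico_eq_Ico (mul_le_of_le_one_right h0 (by linarith)) (le_mul_of_one_le_right h0 (by linarith)),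
    measureReal_union (Ico_disjoint_Ico_same) measurableSet_Ico]

/-- **THE CASCADE BOUND OF THE ONE-STAGE MODEL, `V = 1`**: for `0 ≤ θ`, `0 ≤ ρ`, `2ρ ≤ ρ⋆ ≤ 1` and ANY probability law `μ` on `ℝ`, the masses of the
two-sided shells of the first `n` candidates sum to at most `1` (they are pairwise disjoint — `twoSidedShell_disjoint`). [folklore] -/
theorem sum_measureReal_twoSidedShell_le_one {θ ρ ρstar : ℝ} (hθ : 0 ≤ θ) (hρ0 : 0 ≤ ρ) (h2 : 2 * ρ ≤ ρstar) (h1 : ρstar ≤ 1) (n : ℕ) :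
    ∑ i ∈ range n, μ.real (twoSidedShell θ ρstar ρ i) ≤ 1 := by
  calc ∑ i ∈ range n, μ.real (twoSidedShell θ ρstar ρ i)
      = μ.real (⋃ i ∈ range n, twoSidedShell θ ρstar ρ i) := by
        rw [measureReal_biUnion_finset (fun i _ j _ hij => twoSidedShell_disjoint hθ hρ0 h2 h1 hij) (fun i _ => measurableSet_Ico)]
    _ ≤ μ.real (univ : Set ℝ) := measureReal_mono (subset_univ _)
    _ = 1 := probReal_univ

end Disjoint

/-! ## §2 The run's data: two leaves, one slot, shell parts = the masses below ∕ above the threshold; a realized ledger for EVERY choice function -/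

section Ledger

variable (μ : Measure ℝ) [IsProbabilityMeasure μ] (θ ρs ρ : ℕ → ℝ)

/-- The two leaves exhaust the law: `μ{u < a} + μ{u ≥ a} = 1`. [folklore] -/
theorem leaf_total_eq_one (a : ℝ) : μ.real (Iio a) + μ.real (Ici a) = 1 := by
  rw [← compl_Iio, measureReal_compl measurableSet_Iio, probReal_univ]; ring

/-- The total weight of the two leaves at candidate `i` of step `K` is `1` (sum over `Bool`: `true` = small, `false` = large). [folklore] -/
theorem sum_leaf_eq_one (K i : ℕ) (t : ℝ) :
    ∑ b ∈ (univ : Finset Bool), (fun (K i : ℕ) (_ : ℝ) (b : Bool) =>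
        if b then μ.real (Iio (θ K * (1 - ρs K) ^ i)) else μ.real (Ici (θ K * (1 - ρs K) ^ i))) K i t b = 1 := by
  rw [Fintype.sum_bool]
  simp only [if_true, Bool.false_eq_true, if_false]
  exact leaf_total_eq_one μ _

/-- **THE REALIZED LEDGER OF THE ONE-STAGE RUN, FOR EVERY CHOICE FUNCTION** (`SlotLedger.of_realized` with tilt `a = 0`): terms = the two leaves,
shell part of the small leaf = the mass of its shell BELOW the threshold, of the large leaf = the mass of its shell ABOVE (relative width `ρ_K`; no sign
hypotheses needed: masses are nonnegative and monotone); ONE slot, piece = shell part. [folklore] -/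
theorem realizedLedger (l₀ : ℝ) (c : ℕ → ℕ) :
    SlotLedger l₀ (fun _ => (univ : Finset Bool))
      (fun K => (fun (K i : ℕ) (_ : ℝ) (b : Bool) =>
        if b then μ.real (Iio (θ K * (1 - ρs K) ^ i)) else μ.real (Ici (θ K * (1 - ρs K) ^ i))) K (c K))
      (fun K => (fun (K i : ℕ) (_ : ℝ) (b : Bool) =>
        if b then μ.real (Ico (θ K * (1 - ρs K) ^ i * (1 - ρ K)) (θ K * (1 - ρs K) ^ i)) else μ.real (Ico (θ K * (1 - ρs K) ^ i) (θ K * (1 - ρs K) ^ i * (1 + ρ K)))) K (c K))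
      (fun _ => ({()} : Finset Unit))
      (fun K => (fun (K i : ℕ) (_ : ℝ) (_ : Unit) (b : Bool) =>
        if b then μ.real (Ico (θ K * (1 - ρs K) ^ i * (1 - ρ K)) (θ K * (1 - ρs K) ^ i)) else μ.real (Ico (θ K * (1 - ρs K) ^ i) (θ K * (1 - ρs K) ^ i * (1 + ρ K)))) K (c K))
      (fun K s => Real.exp (2 * 0) *
        ((∑ τ ∈ (univ : Finset Bool), (fun (K i : ℕ) (_ : ℝ) (_ : Unit) (b : Bool) =>
            if b then μ.real (Ico (θ K * (1 - ρs K) ^ i * (1 - ρ K)) (θ K * (1 - ρs K) ^ i)) else μ.real (Ico (θ K * (1 - ρs K) ^ i) (θ K * (1 - ρs K) ^ i * (1 + ρ K)))) K (c K) 0 s τ) /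
          ∑ τ ∈ (univ : Finset Bool), (fun (K i : ℕ) (_ : ℝ) (b : Bool) =>
            if b then μ.real (Iio (θ K * (1 - ρs K) ^ i)) else μ.real (Ici (θ K * (1 - ρs K) ^ i))) K (c K) 0 τ)) := by
  refine SlotLedger.of_realized (a := 0) ?_ ?_ ?_ ?_ ?_ ?_ ?_
  · intro K t _ b _
    cases b <;> exact measureReal_nonneg
  · intro K t _ b _
    cases b
    · simp only [Bool.false_eq_true, if_false]
      exact measureReal_mono (fun x hx => mem_Ici.2 hx.1)
    · simp only [if_true]
      exact measureReal_mono (fun x hx => hx.2)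
  · intro K t _ b _
    rw [Finset.sum_singleton]
  · intro K s _ b _
    cases b <;> exact measureReal_nonneg
  · intro K
    rw [sum_leaf_eq_one μ θ ρs K (c K) 0]; exact one_pos
  · intro K t _ s _
    rw [Real.exp_zero, one_mul]
  · intro K t _
    simp only [Real.exp_zero, one_mul, le_refl]

/-- The candidate-summed shell totals of the run at step `K`: `Σ_{i<n} Σ_s Σ_τ piece = Σ_{i<n} μ(twoSidedShell_i) ≤ 1 = V·Z` with `V = Z = 1`
(§1; `0 ≤ θ_K`, `0 ≤ ρ_K`, `2ρ_K ≤ ρ⋆_K ≤ 1`). [folklore] -/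
theorem candidateTotals_le_one (hθ : ∀ K, 0 ≤ θ K) (hρ0 : ∀ K, 0 ≤ ρ K) (h2 : ∀ K, 2 * ρ K ≤ ρs K) (hs1 : ∀ K, ρs K ≤ 1) (n : ℕ → ℕ) (K : ℕ) :
    ∑ i ∈ range (n K), ∑ s ∈ ({()} : Finset Unit), ∑ τ ∈ (univ : Finset Bool),
        (fun (K i : ℕ) (_ : ℝ) (_ : Unit) (b : Bool) =>
          if b then μ.real (Ico (θ K * (1 - ρs K) ^ i * (1 - ρ K)) (θ K * (1 - ρs K) ^ i)) else μ.real (Ico (θ K * (1 - ρs K) ^ i) (θ K * (1 - ρs K) ^ i * (1 + ρ K)))) K i 0 s τ ≤ 1 * 1 := by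
  rw [one_mul]
  have e : ∀ i, ∑ s ∈ ({()} : Finset Unit), ∑ τ ∈ (univ : Finset Bool),
      (fun (K i : ℕ) (_ : ℝ) (_ : Unit) (b : Bool) =>
        if b then μ.real (Ico (θ K * (1 - ρs K) ^ i * (1 - ρ K)) (θ K * (1 - ρs K) ^ i)) else μ.real (Ico (θ K * (1 - ρs K) ^ i) (θ K * (1 - ρs K) ^ i * (1 + ρ K)))) K i 0 s τ =
      μ.real (twoSidedShell (θ K) (ρs K) (ρ K) i) := by
    intro i
    rw [Finset.sum_singleton, Fintype.sum_bool]
    simp only [if_true, Bool.false_eq_true, if_false]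
    exact measureReal_twoSidedShell_eq μ (hθ K) (hρ0 K) (hs1 K) i
  simp only [e]
  exact sum_measureReal_twoSidedShell_le_one μ (hθ K) (hρ0 K) (h2 K) (hs1 K) (n K)

end Ledger

/-! ## §3 The constructor fires: ONE choice function, `ShellWeightBound` BY NAME, for ANY two probability laws -/

section Fire

variable (μA μB : Measure ℝ) [IsProbabilityMeasure μA] [IsProbabilityMeasure μB] (θ ρA ρB : ℕ → ℝ)

/-- The candidate count at rate `ρ⋆_K = c₁ϑ^K`: with `0 < c₁`, `2c₁ ≤ β′`, `0 < ϑ ≤ 1`, `n_K := ⌊β′∕(c₁ϑ^K)⌋₊ ≥ 1`, the candidates fit under the slack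
(`n_K·c₁ϑ^K ≤ β′`) and `2∕n_K ≤ (4c₁∕β′)·ϑ^K` (`candidateCount_spec`). [folklore] -/
theorem candidateCount_rate {c₁ β' ϑ : ℝ} (hc₁ : 0 < c₁) (h2 : 2 * c₁ ≤ β') (hϑ0 : 0 < ϑ) (hϑ1 : ϑ ≤ 1) (K : ℕ) :
    0 < ⌊β' / (c₁ * ϑ ^ K)⌋₊ ∧ (⌊β' / (c₁ * ϑ ^ K)⌋₊ : ℝ) * (c₁ * ϑ ^ K) ≤ β' ∧ (2 : ℝ) / ⌊β' / (c₁ * ϑ ^ K)⌋₊ ≤ (4 * c₁ / β') * ϑ ^ K := by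
  have hϑK : ϑ ^ K ≤ 1 := pow_le_one₀ hϑ0.le hϑ1
  have hρ : 0 < c₁ * ϑ ^ K := mul_pos hc₁ (pow_pos hϑ0 K)
  have hρ2 : 2 * (c₁ * ϑ ^ K) ≤ β' := by nlinarith
  obtain ⟨h1, h2', h3⟩ := candidateCount_spec hρ hρ2
  exact ⟨h1, h2', h3.trans_eq (by ring)⟩

/-- **THE ONE-STAGE MODEL FIRES `shellWeightBound_of_liveFactor` — FOR ANY TWO PROBABILITY LAWS.**  Data: thresholds `θ_K ≥ 0`; common closeness
radius `ρ⋆_K = c₁ϑ^K` (`0 < c₁`, `2c₁ ≤ β′ ≤ 1`, `0 < ϑ < 1`); shell widths `0 ≤ ρ^A_K, ρ^B_K` with `2ρ^X_K ≤ ρ⋆_K`; `n_K = ⌊β′∕ρ⋆_K⌋₊` candidates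
`θ_K(1 − ρ⋆_K)^i`; run `X`'s terms at candidate `i` = the two leaves of the test `u < θ_K(1 − ρ⋆_K)^i` under `μ_X`, shell parts = the masses of the
shell BELOW (small leaf) and ABOVE (large leaf) the threshold, relative width `ρ^X_K`, `2ρ^X_K ≤ ρ⋆_K`.  Conclusion: ONE choice function `i⋆` (`i⋆ K < n_K`) such that the two runs written with the common factor `(1 − ρ⋆_K)^{i⋆ K}` satisfy
`T4IndicatorShell.ShellWeightBound` BY NAME, with `Wsh K` = the SUM OF THE TWO CHOSEN TWO-SIDED SHELL MASSES `μ_A(twoSidedShell^A_{i⋆K}) +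
μ_B(twoSidedShell^B_{i⋆K})` (the realized ledgers' `ω^A_K + ω^B_K`; summable — inside the constructor `≤ 2·(4c₁∕β′)·ϑ^K`).  Consumed of the laws:
`Σ_i μ_X(twoSidedShell_i) ≤ 1` (§1) — nothing else. [folklore] -/
theorem shellWeightBound_oneStage (l₀ : ℝ) {c₁ β' ϑ : ℝ} (hc₁ : 0 < c₁) (h2 : 2 * c₁ ≤ β') (hβ1 : β' ≤ 1) (hϑ0 : 0 < ϑ) (hϑ1 : ϑ < 1)
    (hθ : ∀ K, 0 ≤ θ K) (hA0 : ∀ K, 0 ≤ ρA K) (hA2 : ∀ K, 2 * ρA K ≤ c₁ * ϑ ^ K) (hB0 : ∀ K, 0 ≤ ρB K) (hB2 : ∀ K, 2 * ρB K ≤ c₁ * ϑ ^ K) :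
    ∃ istar : ℕ → ℕ, (∀ K, istar K < ⌊β' / (c₁ * ϑ ^ K)⌋₊) ∧
      T4IndicatorShell.ShellWeightBound l₀ (fun _ => (univ : Finset Bool))
        (fun K => (fun (K i : ℕ) (_ : ℝ) (b : Bool) =>
          if b then μA.real (Iio (θ K * (1 - c₁ * ϑ ^ K) ^ i)) else μA.real (Ici (θ K * (1 - c₁ * ϑ ^ K) ^ i))) K (istar K))
        (fun K => (fun (K i : ℕ) (_ : ℝ) (b : Bool) =>
          if b then μB.real (Iio (θ K * (1 - c₁ * ϑ ^ K) ^ i)) else μB.real (Ici (θ K * (1 - c₁ * ϑ ^ K) ^ i))) K (istar K))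
        (fun K => (fun (K i : ℕ) (_ : ℝ) (b : Bool) =>
          if b then μA.real (Ico (θ K * (1 - c₁ * ϑ ^ K) ^ i * (1 - ρA K)) (θ K * (1 - c₁ * ϑ ^ K) ^ i)) else μA.real (Ico (θ K * (1 - c₁ * ϑ ^ K) ^ i) (θ K * (1 - c₁ * ϑ ^ K) ^ i * (1 + ρA K)))) K (istar K))
        (fun K => (fun (K i : ℕ) (_ : ℝ) (b : Bool) =>
          if b then μB.real (Ico (θ K * (1 - c₁ * ϑ ^ K) ^ i * (1 - ρB K)) (θ K * (1 - c₁ * ϑ ^ K) ^ i)) else μB.real (Ico (θ K * (1 - c₁ * ϑ ^ K) ^ i) (θ K * (1 - c₁ * ϑ ^ K) ^ i * (1 + ρB K)))) K (istar K))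
        (fun K => μA.real (twoSidedShell (θ K) (c₁ * ϑ ^ K) (ρA K) (istar K)) + μB.real (twoSidedShell (θ K) (c₁ * ϑ ^ K) (ρB K) (istar K))) := by
  have hs1 : ∀ K, c₁ * ϑ ^ K ≤ 1 := fun K => by
    have := mul_le_mul_of_nonneg_left (pow_le_one₀ hϑ0.le hϑ1.le : ϑ ^ K ≤ 1) hc₁.le
    linarith
  have hrate := fun K => candidateCount_rate hc₁ h2 hϑ0 hϑ1.le K
  have hlA := fun c => realizedLedger μA θ (fun K => c₁ * ϑ ^ K) ρA l₀ c
  have hlB := fun c => realizedLedger μB θ (fun K => c₁ * ϑ ^ K) ρB l₀ c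
  obtain ⟨istar, hlt, hSWB⟩ := shellWeightBound_of_liveFactor (l₀ := l₀) (a := 0) (ϑ := ϑ) (V := 1) (M := 4 * c₁ / β')
    (T := fun _ => (univ : Finset Bool))
    (A := fun (K i : ℕ) (_ : ℝ) (b : Bool) => if b then μA.real (Iio (θ K * (1 - c₁ * ϑ ^ K) ^ i)) else μA.real (Ici (θ K * (1 - c₁ * ϑ ^ K) ^ i)))
    (B := fun (K i : ℕ) (_ : ℝ) (b : Bool) => if b then μB.real (Iio (θ K * (1 - c₁ * ϑ ^ K) ^ i)) else μB.real (Ici (θ K * (1 - c₁ * ϑ ^ K) ^ i)))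
    (shA := fun (K i : ℕ) (_ : ℝ) (b : Bool) => if b then μA.real (Ico (θ K * (1 - c₁ * ϑ ^ K) ^ i * (1 - ρA K)) (θ K * (1 - c₁ * ϑ ^ K) ^ i)) else μA.real (Ico (θ K * (1 - c₁ * ϑ ^ K) ^ i) (θ K * (1 - c₁ * ϑ ^ K) ^ i * (1 + ρA K))))
    (shB := fun (K i : ℕ) (_ : ℝ) (b : Bool) => if b then μB.real (Ico (θ K * (1 - c₁ * ϑ ^ K) ^ i * (1 - ρB K)) (θ K * (1 - c₁ * ϑ ^ K) ^ i)) else μB.real (Ico (θ K * (1 - c₁ * ϑ ^ K) ^ i) (θ K * (1 - c₁ * ϑ ^ K) ^ i * (1 + ρB K))))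
    (SA := fun _ => ({()} : Finset Unit)) (SB := fun _ => ({()} : Finset Unit))
    (pieceA := fun (K i : ℕ) (_ : ℝ) (_ : Unit) (b : Bool) =>
      if b then μA.real (Ico (θ K * (1 - c₁ * ϑ ^ K) ^ i * (1 - ρA K)) (θ K * (1 - c₁ * ϑ ^ K) ^ i)) else μA.real (Ico (θ K * (1 - c₁ * ϑ ^ K) ^ i) (θ K * (1 - c₁ * ϑ ^ K) ^ i * (1 + ρA K))))
    (pieceB := fun (K i : ℕ) (_ : ℝ) (_ : Unit) (b : Bool) =>
      if b then μB.real (Ico (θ K * (1 - c₁ * ϑ ^ K) ^ i * (1 - ρB K)) (θ K * (1 - c₁ * ϑ ^ K) ^ i)) else μB.real (Ico (θ K * (1 - c₁ * ϑ ^ K) ^ i) (θ K * (1 - c₁ * ϑ ^ K) ^ i * (1 + ρB K))))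
    (fun K => ⌊β' / (c₁ * ϑ ^ K)⌋₊) (fun K => (hrate K).1) hlA hlB
    (fun K i => sum_nonneg fun s _ => sum_nonneg fun b _ => by cases b <;> simp [measureReal_nonneg])
    (fun K i => sum_nonneg fun s _ => sum_nonneg fun b _ => by cases b <;> simp [measureReal_nonneg])
    (ZA := fun _ => 1) (ZB := fun _ => 1) (fun _ => one_pos) (fun _ => one_pos)
    (fun K i => (sum_leaf_eq_one μA θ (fun K => c₁ * ϑ ^ K) K i 0).symm.le)
    (fun K i => (sum_leaf_eq_one μB θ (fun K => c₁ * ϑ ^ K) K i 0).symm.le)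
    zero_le_one
    (fun K => candidateTotals_le_one μA θ (fun K => c₁ * ϑ ^ K) ρA hθ hA0 hA2 hs1 (fun K => ⌊β' / (c₁ * ϑ ^ K)⌋₊) K)
    (fun K => candidateTotals_le_one μB θ (fun K => c₁ * ϑ ^ K) ρB hθ hB0 hB2 hs1 (fun K => ⌊β' / (c₁ * ϑ ^ K)⌋₊) K)
    (fun K => (hrate K).2.2) hϑ0.le hϑ1
  refine ⟨istar, hlt, ?_⟩
  have e : (fun K => (hlA istar).omega K + (hlB istar).omega K) =
      (fun K => μA.real (twoSidedShell (θ K) (c₁ * ϑ ^ K) (ρA K) (istar K)) + μB.real (twoSidedShell (θ K) (c₁ * ϑ ^ K) (ρB K) (istar K))) := by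
    funext K
    simp only [SlotLedger.omega, Finset.sum_singleton, Fintype.sum_bool, if_true, Bool.false_eq_true, if_false, mul_zero,
      Real.exp_zero, one_mul]
    rw [leaf_total_eq_one, leaf_total_eq_one, div_one, div_one, measureReal_twoSidedShell_eq μA (hθ K) (hA0 K) (hs1 K),
      measureReal_twoSidedShell_eq μB (hθ K) (hB0 K) (hs1 K)]
  rw [← e]
  exact hSWB

/-- **THE CHOSEN THRESHOLDS STAY IN THE PRINTED SLACK** (the domain on which (L1-step) is read): every candidate threshold `θ_K(1 − ρ⋆_K)^i`, `i < n_K`,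
lies in `[θ_K(1 − β′), θ_K]` (Bernoulli and `n_K·ρ⋆_K ≤ β′`; `0 < c₁`, `2c₁ ≤ β′ ≤ 1`, `0 < ϑ ≤ 1`). [folklore] -/
theorem chosen_threshold_mem_slack {c₁ β' ϑ : ℝ} (hc₁ : 0 < c₁) (h2 : 2 * c₁ ≤ β') (hβ1 : β' ≤ 1) (hϑ0 : 0 < ϑ) (hϑ1 : ϑ ≤ 1)
    (hθ : ∀ K, 0 ≤ θ K) (K : ℕ) {i : ℕ} (hi : i < ⌊β' / (c₁ * ϑ ^ K)⌋₊) :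
    θ K * (1 - β') ≤ θ K * (1 - c₁ * ϑ ^ K) ^ i ∧ θ K * (1 - c₁ * ϑ ^ K) ^ i ≤ θ K := by
  obtain ⟨-, hnρ, -⟩ := candidateCount_rate hc₁ h2 hϑ0 hϑ1 K
  set ρ := c₁ * ϑ ^ K with hρ
  set n := ⌊β' / (c₁ * ϑ ^ K)⌋₊ with hn
  have hρ0 : 0 ≤ ρ := (mul_pos hc₁ (pow_pos hϑ0 K)).le
  have hρ1 : ρ ≤ 1 := by
    have := mul_le_mul_of_nonneg_left (pow_le_one₀ hϑ0.le hϑ1 : ϑ ^ K ≤ 1) hc₁.le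
    rw [hρ]; linarith
  have hl1 : (1 - ρ) ^ i ≤ 1 := pow_le_one₀ (by linarith) (by linarith)
  refine ⟨?_, mul_le_of_le_one_right (hθ K) hl1⟩
  have hb : 1 + (n : ℝ) * (-ρ) ≤ (1 + (-ρ)) ^ n := one_add_mul_le_pow (by linarith) n
  have hmono : (1 - ρ) ^ n ≤ (1 - ρ) ^ i := pow_le_pow_of_le_one (by linarith) (by linarith) hi.le
  refine mul_le_mul_of_nonneg_left ?_ (hθ K)
  calc 1 - β' ≤ 1 - (n : ℝ) * ρ := by linarith
    _ = 1 + (n : ℝ) * (-ρ) := by ring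
    _ ≤ (1 + (-ρ)) ^ n := hb
    _ = (1 - ρ) ^ n := by rw [← sub_eq_add_neg]
    _ ≤ (1 - ρ) ^ i := hmono

end Fire

end Summit.QuantumFields.BalabanUV.T4Continuum.Spine.NE7c.LiveFactorOneStageModel

end
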